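import Mathlib
import HarnessLib
import Summits.HubbardSuperconductivity.HubbardSuperconductivity.Theorems.KLProgrammeKLRegimeTwoVolumeBlockDefect
import Literature.MathematicalPhysics.QuantumLattice.HubbardGridFieldSubstitution
import Literature.Probability.LatticeModels.TorusCentredLift

/-!
# The near-defect ENTRY bound from FIBRE-SECTIONAL tails (β′ nested two-volume pass; ε-homogeneity repair of the block step)

`…TwoVolumeBlockDefect.norm_near_le` bounds every entry of the near defect `D_near` by the far ROW tail `T = sup_X′ Σ_{Far X′ Y′} ‖C′ X′ Y′‖`.
In the grid model that tail sums over all `N` times and is `Θ((N/β)·t(R))`, while `T` is then fed into the ENTRY-SUP slot `s` of the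
near-identity step (`Σ_j comb · s^j · N(m+2j)`), which loses a factor `N/β` per power (RATE-HOMOGENEITY-g6.md).  The near entries are in fact
(G1) single far entries or (G2) winding sums over the FIBRE of `Y′` minus `Y′`, and a fibre has a fixed time, spin and charge; so they are
bounded by the far part of ONE fibre sum:

* `norm_near_le_of_fibreTail` (abstract): `‖D_near X′ Y′‖ ≤ Te` from `Σ_{Y″ : π Y″ = π Y′, Far X′ Y″} ‖C′ X′ Y″‖ ≤ Te`;
* `sum_fibre_far_norm_le_of_sectional` (grid model, boxes `⌊x/L⌋`): that fibre tail is at most the FIXED-TIME far spatial sum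
  `Σ_{y : R < tnorm(x′ − y)} ‖C′ X′ (((t, y), σ), c)‖` at `(t, σ, c)` = those of `Y′` — an `ε`-free one-volume datum.
-/

namespace Summit.HubbardSuperconductivity.HubbardSuperconductivity.Theorems.TwoVolumeDefect

open Finset Literature.MathematicalPhysics.QuantumLattice Literature.Probability.LatticeModels

universe u

section Abstract

variable {𝕜 : Type*} [RCLike 𝕜] {Γ ι : Type*} {Γ' : Type u} (e : Γ' ≃ ι × Γ)

/-- **Near entries are FIBRE-tail-small**: `‖D_near X′ Y′‖ ≤ Te` whenever the far part of every fibre sum is `≤ Te`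
(`Σ_{Y″ : π Y″ = π Y′ ∧ Far X′ Y″} ‖C′ X′ Y″‖ ≤ Te`), given (G1)/(G2).  Compared with `norm_near_le` the bound is by ONE fibre's far
entries, not the whole far row. [folklore] -/
theorem norm_near_le_of_fibreTail [Fintype Γ'] [DecidableEq Γ'] [DecidableEq Γ] [DecidableEq ι] (C : Matrix Γ Γ 𝕜)
    (C' Ccop Dn : Matrix Γ' Γ' 𝕜) (Zs : Set Γ') [DecidablePred (· ∈ Zs)]
    (hCcop : ∀ X' Y', Ccop X' Y' = if (e X').1 = (e Y').1 then C (e X').2 (e Y').2 else 0)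
    (hDn : ∀ X' Y', Dn X' Y' = if X' ∈ Zs ∧ Y' ∈ Zs then 0 else C' X' Y' - Ccop X' Y')
    (hP : ∀ (X' : Γ') (Y : Γ), ∑ Y'' ∈ univ.filter (fun Y'' : Γ' => (e Y'').2 = Y), C' X' Y'' = C (e X').2 Y)
    (Far : Γ' → Γ' → Prop) [∀ X' Y', Decidable (Far X' Y')]
    (hG1 : ∀ X' Y', (e X').1 ≠ (e Y').1 → ¬ (X' ∈ Zs ∧ Y' ∈ Zs) → Far X' Y')
    (hG2 : ∀ X' Y' Y'', (e X').1 = (e Y').1 → (e Y'').2 = (e Y').2 → Y'' ≠ Y' → ¬ (X' ∈ Zs ∧ Y' ∈ Zs) → Far X' Y'')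
    {Te : ℝ} (hTe : ∀ X' Y', ∑ Y'' ∈ univ.filter (fun Y'' : Γ' => (e Y'').2 = (e Y').2 ∧ Far X' Y''), ‖C' X' Y''‖ ≤ Te) (X' Y' : Γ') :
    ‖Dn X' Y'‖ ≤ Te := by
  have hTe0 : 0 ≤ Te := (sum_nonneg fun Y'' _ => norm_nonneg (C' X' Y'')).trans (hTe X' Y')
  by_cases hnz : X' ∈ Zs ∧ Y' ∈ Zs
  · rw [hDn, if_pos hnz, norm_zero]; exact hTe0
  by_cases heq : (e X').1 = (e Y').1
  · rw [near_apply_of_blk_eq e C C' Ccop Dn Zs hCcop hDn hP heq hnz, norm_neg]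
    refine (norm_sum_le _ _).trans ((Finset.sum_le_sum_of_subset_of_nonneg ?_ fun _ _ _ => norm_nonneg _).trans (hTe X' Y'))
    intro Y'' hY''
    simp only [mem_erase, mem_filter, mem_univ, true_and] at hY'' ⊢
    exact ⟨hY''.2, hG2 X' Y' Y'' heq hY''.2 hY''.1 hnz⟩
  · rw [near_apply_of_blk_ne e C C' Ccop Dn Zs hCcop hDn heq hnz]
    exact (Finset.single_le_sum (f := fun Y'' => ‖C' X' Y''‖) (fun _ _ => norm_nonneg _)
      (by simpa only [mem_filter, mem_univ, true_and] using hG1 X' Y' heq hnz)).trans (hTe X' Y')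

end Abstract

/-! ## The grid model: fibre tails are fixed-time far spatial sums -/

section Grid

variable {b L Lf N : ℕ} [NeZero Lf]

/-- On the grid legs with the `⌊x/L⌋` block structure (`he2`: the projection is the coordinatewise reduction of the site, time/spin/charge
kept), the fibre of `Y′` consists of legs with the SAME time, spin and charge as `Y′`; hence the far part of a fibre sum of `‖C′ X′ ·‖` with
`Far = (R < tnorm of the site difference)` is at most the fixed-time far spatial sum at `(t, σ, c)` of `Y′`. -/
theorem sum_fibre_far_norm_le_of_sectional (e : GridLeg (GridPoint Lf N) ≃ (Fin 2 → Fin b) × GridLeg (GridPoint L N))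
    (he2 : ∀ X', (e X').2 = (((X'.1.1.1, fun i => (((X'.1.1.2 i).val : ℕ) : ZMod L)), X'.1.2), X'.2))
    (C' : Matrix (GridLeg (GridPoint Lf N)) (GridLeg (GridPoint Lf N)) ℂ) (R : ℕ) {Te : ℝ}
    (hsec : ∀ (X' : GridLeg (GridPoint Lf N)) (t : Fin N) (σ c : Fin 2),
      ∑ y ∈ univ.filter (fun y : TorusSite 2 Lf => R < Torus.tnorm (X'.1.1.2 - y)), ‖C' X' (((t, y), σ), c)‖ ≤ Te)
    (X' Y' : GridLeg (GridPoint Lf N)) :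
    ∑ Y'' ∈ univ.filter (fun Y'' : GridLeg (GridPoint Lf N) => (e Y'').2 = (e Y').2 ∧ R < Torus.tnorm (X'.1.1.2 - Y''.1.1.2)),
      ‖C' X' Y''‖ ≤ Te := by
  classical
  -- the legs with the time/spin/charge of `Y′` are parametrised by their site
  set emb : TorusSite 2 Lf → GridLeg (GridPoint Lf N) := fun y => (((Y'.1.1.1, y), Y'.1.2), Y'.2) with hemb
  have hemb_inj : Function.Injective emb := by
    intro y₁ y₂ h
    simpa [hemb, Prod.mk.injEq] using h
  refine le_trans ?_ (hsec X' Y'.1.1.1 Y'.1.2 Y'.2)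
  rw [← sum_image (f := fun Y'' => ‖C' X' Y''‖) fun y₁ _ y₂ _ h => hemb_inj h]
  refine sum_le_sum_of_subset_of_nonneg ?_ fun _ _ _ => norm_nonneg _
  intro Y'' hY''
  simp only [mem_filter, mem_univ, true_and] at hY''
  obtain ⟨hfib, hfar⟩ := hY''
  rw [he2, he2] at hfib
  simp only [Prod.mk.injEq] at hfib
  obtain ⟨⟨⟨ht, -⟩, hσ⟩, hc⟩ := hfib
  refine mem_image.2 ⟨Y''.1.1.2, mem_filter.2 ⟨mem_univ _, hfar⟩, ?_⟩
  simp only [hemb]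
  rw [← ht, ← hσ, ← hc]

/-- **The near-defect entry bound of the grid model from the sectional tail** (composition of the two lemmas above, in the block step's
notation): with `Ccop`, `Dn`, `Zs` as in `hubbardGrid_sum_norm_kernel_sub_le` and `Far X′ Y′ := R < tnorm(x′ − y′)`,
`‖Dn X′ Y′‖ ≤ Te` for `Te` any bound of the fixed-time far spatial sums of `C′`. -/
theorem norm_near_le_of_sectional (e : GridLeg (GridPoint Lf N) ≃ (Fin 2 → Fin b) × GridLeg (GridPoint L N))
    (he2 : ∀ X', (e X').2 = (((X'.1.1.1, fun i => (((X'.1.1.2 i).val : ℕ) : ZMod L)), X'.1.2), X'.2))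
    (C : Matrix (GridLeg (GridPoint L N)) (GridLeg (GridPoint L N)) ℂ)
    (C' Ccop Dn : Matrix (GridLeg (GridPoint Lf N)) (GridLeg (GridPoint Lf N)) ℂ) (Zs : Set (GridLeg (GridPoint Lf N)))
    [DecidablePred (· ∈ Zs)]
    (hCcop : ∀ X' Y', Ccop X' Y' = if (e X').1 = (e Y').1 then C (e X').2 (e Y').2 else 0)
    (hDn : ∀ X' Y', Dn X' Y' = if X' ∈ Zs ∧ Y' ∈ Zs then 0 else C' X' Y' - Ccop X' Y')
    (hP : ∀ (X' : GridLeg (GridPoint Lf N)) (Y : GridLeg (GridPoint L N)),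
      ∑ Y'' ∈ univ.filter (fun Y'' : GridLeg (GridPoint Lf N) => (e Y'').2 = Y), C' X' Y'' = C (e X').2 Y)
    (R : ℕ)
    (hG1 : ∀ X' Y', (e X').1 ≠ (e Y').1 → ¬ (X' ∈ Zs ∧ Y' ∈ Zs) → R < Torus.tnorm (X'.1.1.2 - Y'.1.1.2))
    (hG2 : ∀ X' Y' Y'', (e X').1 = (e Y').1 → (e Y'').2 = (e Y').2 → Y'' ≠ Y' → ¬ (X' ∈ Zs ∧ Y' ∈ Zs) →
      R < Torus.tnorm (X'.1.1.2 - Y''.1.1.2))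
    {Te : ℝ}
    (hsec : ∀ (X' : GridLeg (GridPoint Lf N)) (t : Fin N) (σ c : Fin 2),
      ∑ y ∈ univ.filter (fun y : TorusSite 2 Lf => R < Torus.tnorm (X'.1.1.2 - y)), ‖C' X' (((t, y), σ), c)‖ ≤ Te)
    (X' Y' : GridLeg (GridPoint Lf N)) : ‖Dn X' Y'‖ ≤ Te := by
  classical
  exact norm_near_le_of_fibreTail e C C' Ccop Dn Zs hCcop hDn hP (fun X' Y' => R < Torus.tnorm (X'.1.1.2 - Y'.1.1.2)) hG1 hG2
    (fun X'' Y'' => sum_fibre_far_norm_le_of_sectional e he2 C' R hsec X'' Y'') X' Y'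

/-- **The sectional tail from a WEIGHTED SUP ENTRY** (the `ε`-free one-volume datum): if `‖C′ X′ Y′‖·φ(tnorm(x′ − y′)) ≤ s` for a weight
`φ ≥ 0`, positive beyond `R`, then the fixed-time far spatial sums are `≤ s · Σ_{z : R < tnorm z} φ(tnorm z)⁻¹`. -/
theorem sectional_tail_le_of_weightedSup (C' : Matrix (GridLeg (GridPoint Lf N)) (GridLeg (GridPoint Lf N)) ℂ) (R : ℕ)
    (φ : ℕ → ℝ) (hφ : ∀ n, R < n → 0 < φ n) {s : ℝ}
    (hs : ∀ X' Y', ‖C' X' Y'‖ * φ (Torus.tnorm (X'.1.1.2 - Y'.1.1.2)) ≤ s)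
    (X' : GridLeg (GridPoint Lf N)) (t : Fin N) (σ c : Fin 2) :
    ∑ y ∈ univ.filter (fun y : TorusSite 2 Lf => R < Torus.tnorm (X'.1.1.2 - y)), ‖C' X' (((t, y), σ), c)‖ ≤
      s * ∑ z ∈ univ.filter (fun z : TorusSite 2 Lf => R < Torus.tnorm z), (φ (Torus.tnorm z))⁻¹ := by
  classical
  rw [mul_sum]
  -- reindex the right side by `y = x′ − z`
  have hre : ∑ z ∈ univ.filter (fun z : TorusSite 2 Lf => R < Torus.tnorm z), s * (φ (Torus.tnorm z))⁻¹ =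
      ∑ y ∈ univ.filter (fun y : TorusSite 2 Lf => R < Torus.tnorm (X'.1.1.2 - y)), s * (φ (Torus.tnorm (X'.1.1.2 - y)))⁻¹ := by
    rw [Finset.sum_filter, Finset.sum_filter]
    exact (Equiv.sum_comp (Equiv.subLeft X'.1.1.2) (fun z => if R < Torus.tnorm z then s * (φ (Torus.tnorm z))⁻¹ else 0)).symm
  rw [hre]
  refine sum_le_sum fun y hy => ?_
  simp only [mem_filter, mem_univ, true_and] at hy
  have hφy := hφ _ hy
  rw [← div_eq_mul_inv, le_div_iff₀ hφy]
  exact hs X' (((t, y), σ), c)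

end Grid

end Summit.HubbardSuperconductivity.HubbardSuperconductivity.Theorems.TwoVolumeDefect
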